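import Summits.CriticalPhenomena.CardyFormulaZ2.Theorems.CardyBoundaryCoulombGasBoundaryDefectGaussianRStubTransfer

/-!
# Stub `stub_transferV2` of line `rainbow-monomials-in-excursion-kernels` — crux `BoundaryDefectGaussianR`
# (stmt-CriticalPhenomena-14132): the transfer with the corrected reference-limit hypothesis REFV2

The referenceLimit worker showed that the registered REFERENCE_LIMIT text is false for degenerate
leg families (no source, `k = 1`; or a source with `L i = 0`): `IsAdmissible` requires a nonempty
source set with leg numbers `≥ 1`, so no reference domain is APPROXIMABLE
(`…StubReferenceLimitPart5.not_approximable_one`). REFV2 is the registered text with the two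
non-degeneracy hypotheses `(∃ i, i ≠ j) → (∀ i, i ≠ j → 1 ≤ L i) →` inserted after the family
hypothesis; RIGIDITY and the GREEN-kernel asymptotics are the registered texts verbatim.

* `s6_transferDegenerate` (registered sub-goal) — for a DEGENERATE family the crux's conclusion
  holds vacuously (with `C = 1`): admissibility of the crux's lattice data at `n = 0` already gives
  a source and positive source leg numbers.
* `stub_transferV2 : RIGIDITY → REFV2 → GREEN → BoundaryDefectGaussianR` — classical case split on
  non-degeneracy; the non-degenerate case is the proof of `stub_transfer`
  (`…StubTransfer.lean`: flat-mark geometry `s6_flatMarkGeometry`, shifted reference data,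
  `F_n → ℓ`, Green asymptotics for every pair, `transfer_limit`, `transfer_limit_value`).
-/

noncomputable section

open Filter Topology
open Literature.Probability.LatticeModels Literature.Probability.RandomPlanarGeometry

namespace Summit.CriticalPhenomena.CardyFormulaZ2.Cruxes.BoundaryDefectGaussianR.RainbowMonomialsInExcursionKernels

/-- **Registered sub-goal `s6_transferDegenerate`.** For a degenerate leg family — no source
(`∀ i, i = j`) or a source with leg number `0` — the conclusion of the crux
`BoundaryDefectGaussianR` for that family holds vacuously (constant `C = 1`): the crux's
admissibility hypothesis at `n = 0` provides a nonempty source set, i.e. some `i ≠ j`, and source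
leg numbers `≥ 1` (the insertion map is injective, so the leg number at `p 0 i` is `L i`). [folklore] -/
theorem s6_transferDegenerate :
    ∀ (k : ℕ) (L : Fin k → ℕ) (j : Fin k), ¬ ((∃ i, i ≠ j) ∧ (∀ i, i ≠ j → 1 ≤ L i)) → ∃ C : ℝ, 0 < C ∧ ∀ (D :
    Literature.Probability.RandomPlanarGeometry.MarkedDomain k), (∃ S : Finset (ℂ × ℂ), (∀ p ∈ S, p.1.re =
    p.2.re ∨ p.1.im = p.2.im) ∧ frontier D.carrier ⊆ ⋃ p ∈ S, segment ℝ p.1 p.2) → (∀ i, ∃ r : ℝ, 0 < r ∧ ((∀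
    z ∈ frontier D.carrier, dist z (D.pt i) < r → z.im = (D.pt i).im) ∨ (∀ z ∈ frontier D.carrier, dist z
    (D.pt i) < r → z.re = (D.pt i).re))) → ∀ (w : ℂ → ℂ) (U : Set ℂ), IsOpen U → D.carrier ⊆ U → (∀ i, D.pt i
    ∈ U) → DifferentiableOn ℂ w U → Set.BijOn w D.carrier {z : ℂ | 0 < z.im} → (∀ i, ∃ ε : ℝ, 0 < ε ∧
    StrictMonoOn (fun t : ℝ ↦ (w (D.boundary t)).re) (Set.Ioo (D.mark i - ε) (D.mark i + ε))) → ∀ (δ : ℕ → ℝ),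
    (∀ n, 0 < δ n) → Filter.Tendsto δ Filter.atTop (nhds 0) → ∀ (V : ℕ → Finset (ℤ × ℤ)), (∀ n, ∀ v : ℤ × ℤ, v
    ∈ V n ↔ ((v.1 : ℂ) * δ n + (v.2 : ℂ) * δ n * Complex.I) ∈ closure D.carrier) → ∀ (p : ℕ → Fin k → ℤ × ℤ),
    (∀ n, Function.Injective (p n)) → (∀ i, Filter.Tendsto (fun n ↦ ((p n i).1 : ℂ) * δ n + ((p n i).2 : ℂ) *
    δ n * Complex.I) Filter.atTop (nhds (D.pt i))) → (∀ n,
    Literature.Probability.LatticeModels.CollarLegModel.LegInsertionData.IsAdmissible ⟨(Finset.univ.erase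
    j).image (p n), fun v ↦ ∑ i ∈ (Finset.univ.erase j).filter (fun i ↦ p n i = v), L i, p n j⟩ (V n)) →
    Filter.Tendsto (fun n ↦ (δ n) ^ (-(∑ i : Fin k, (if i = j then (1 - (L j : ℝ)) else (L i : ℝ)) * ((if i =
    j then (1 - (L j : ℝ)) else (L i : ℝ)) - 1) / 6)) *
    ‖Literature.Probability.LatticeModels.CollarLegModel.Zins (V n) ⟨(Finset.univ.erase j).image (p n), fun v
    ↦ ∑ i ∈ (Finset.univ.erase j).filter (fun i ↦ p n i = v), L i, p n j⟩‖ /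
    ‖(Literature.Probability.LatticeModels.CollarLegModel.ofDomain (V n)).Z‖) Filter.atTop (nhds (C * (∏ i :
    Fin k, ∏ i' ∈ Finset.univ.filter (fun i' : Fin k ↦ i < i'), ‖w (D.pt i) - w (D.pt i')‖ ^ ((if i = j then
    (1 - (L j : ℝ)) else (L i : ℝ)) * (if i' = j then (1 - (L j : ℝ)) else (L i' : ℝ)) / 3)) * ∏ i : Fin k,
    ‖deriv w (D.pt i)‖ ^ ((if i = j then (1 - (L j : ℝ)) else (L i : ℝ)) * ((if i = j then (1 - (L j : ℝ))
    else (L i : ℝ)) - 1) / 6))) := by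
  intro k L j hnd
  refine ⟨1, one_pos, ?_⟩
  intro D _ _ w U _ _ _ _ _ _ δ _ _ V _ p hpinj _ hadm
  exfalso
  apply hnd
  obtain ⟨⟨x, hx⟩, hlegs, -⟩ := hadm 0
  obtain ⟨i, hi, rfl⟩ := Finset.mem_image.1 hx
  refine ⟨⟨i, (Finset.mem_erase.1 hi).1⟩, fun i' hi' ↦ ?_⟩
  have hm : i' ∈ Finset.univ.erase j := Finset.mem_erase.2 ⟨hi', Finset.mem_univ _⟩
  have hsum : ∑ b ∈ (Finset.univ.erase j).filter (fun b ↦ p 0 b = p 0 i'), L b = L i' :=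
    Finset.sum_eq_single_of_mem i' (Finset.mem_filter.2 ⟨hm, rfl⟩)
      (fun b hb hne ↦ absurd (hpinj 0 (Finset.mem_filter.1 hb).2) hne)
  have h1 := hlegs (p 0 i') (Finset.mem_image_of_mem (p 0) hm)
  simp only at h1
  rwa [hsum] at h1

/-- **Stub 6, v2 — transfer (limit algebra) with the corrected reference limit.** RIGIDITY → REFV2
→ GREEN KERNEL ASYMPTOTICS → the crux `BoundaryDefectGaussianR` BY NAME; REFV2 = the registered
REFERENCE_LIMIT with the non-degeneracy hypotheses `(∃ i, i ≠ j)`, `(∀ i, i ≠ j → 1 ≤ L i)`.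
Degenerate families: `s6_transferDegenerate`; non-degenerate families: verbatim the proof of
`stub_transfer` (constant `C = e^ℓ · c^{Σ_{i<i'}(−e_ie_i'/6)}`). [folklore] -/
theorem stub_transferV2 :
    (∀ (k : ℕ) (L : Fin k → ℕ) (j : Fin k), L j = ∑ i ∈ Finset.univ.erase j, L i → ∀ (D D' :
    Literature.Probability.RandomPlanarGeometry.MarkedDomain k), (∃ S : Finset (ℂ × ℂ), (∀ q ∈ S, q.1.re =
    q.2.re ∨ q.1.im = q.2.im) ∧ frontier D.carrier ⊆ ⋃ q ∈ S, segment ℝ q.1 q.2) → (∀ i, (∃ r : ℝ, 0 < r ∧ ((∀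
    z ∈ frontier D.carrier, dist z (D.pt i) < r → z.im = (D.pt i).im) ∨ (∀ z ∈ frontier D.carrier, dist z
    (D.pt i) < r → z.re = (D.pt i).re)))) → (∃ τ : ℂ, ‖τ‖ = 1 ∧ (∃ ε : ℝ, 0 < ε ∧ ∀ t ∈ Set.Ioo (D.mark j)
    (D.mark j + ε), ∃ s : ℝ, 0 < s ∧ D.boundary t = D.pt j + (s : ℂ) * τ) ∧ (∃ ε : ℝ, 0 < ε ∧ ∀ s ∈ Set.Ioo (0
    : ℝ) ε, D.pt j + (s : ℂ) * (τ * Complex.I) ∈ D.carrier)) → (∃ S : Finset (ℂ × ℂ), (∀ q ∈ S, q.1.re =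
    q.2.re ∨ q.1.im = q.2.im) ∧ frontier D'.carrier ⊆ ⋃ q ∈ S, segment ℝ q.1 q.2) → (∀ i, (∃ r : ℝ, 0 < r ∧
    ((∀ z ∈ frontier D'.carrier, dist z (D'.pt i) < r → z.im = (D'.pt i).im) ∨ (∀ z ∈ frontier D'.carrier,
    dist z (D'.pt i) < r → z.re = (D'.pt i).re)))) → (∃ τ : ℂ, ‖τ‖ = 1 ∧ (∃ ε : ℝ, 0 < ε ∧ ∀ t ∈ Set.Ioo
    (D'.mark j) (D'.mark j + ε), ∃ s : ℝ, 0 < s ∧ D'.boundary t = D'.pt j + (s : ℂ) * τ) ∧ (∃ ε : ℝ, 0 < ε ∧ ∀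
    s ∈ Set.Ioo (0 : ℝ) ε, D'.pt j + (s : ℂ) * (τ * Complex.I) ∈ D'.carrier)) → ∀ (δ : ℕ → ℝ), (∀ n, 0 < δ n)
    → Filter.Tendsto δ Filter.atTop (nhds 0) → ∀ (V V' : ℕ → Finset (ℤ × ℤ)), (∀ n, ∀ v : ℤ × ℤ, v ∈ V n ↔
    (((v).1 : ℂ) * ((δ n : ℝ) : ℂ) + ((v).2 : ℂ) * ((δ n : ℝ) : ℂ) * Complex.I) ∈ closure D.carrier) → (∀ n, ∀
    v : ℤ × ℤ, v ∈ V' n ↔ (((v).1 : ℂ) * ((δ n : ℝ) : ℂ) + ((v).2 : ℂ) * ((δ n : ℝ) : ℂ) * Complex.I) ∈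
    closure D'.carrier) → ∀ (p p' : ℕ → Fin k → ℤ × ℤ), (∀ n, Function.Injective ((p) n)) → (∀ n,
    Function.Injective ((p') n)) → (∀ i, Filter.Tendsto (fun n ↦ ((((p) n i).1 : ℂ) * ((δ n : ℝ) : ℂ) + (((p)
    n i).2 : ℂ) * ((δ n : ℝ) : ℂ) * Complex.I)) Filter.atTop (nhds (D.pt i))) → (∀ i, Filter.Tendsto (fun n ↦
    ((((p') n i).1 : ℂ) * ((δ n : ℝ) : ℂ) + (((p') n i).2 : ℂ) * ((δ n : ℝ) : ℂ) * Complex.I)) Filter.atTop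
    (nhds (D'.pt i))) → (∀ n,
    Literature.Probability.LatticeModels.CollarLegModel.LegInsertionData.IsAdmissible (⟨(Finset.univ.erase
    j).image ((p) n), fun v ↦ ∑ b ∈ (Finset.univ.erase j).filter (fun b ↦ ((p) n) b = v), L b, ((p) n) j⟩ :
    Literature.Probability.LatticeModels.CollarLegModel.LegInsertionData) (V n)) → (∀ n,
    Literature.Probability.LatticeModels.CollarLegModel.LegInsertionData.IsAdmissible (⟨(Finset.univ.erase
    j).image ((p') n), fun v ↦ ∑ b ∈ (Finset.univ.erase j).filter (fun b ↦ ((p') n) b = v), L b, ((p') n) j⟩ :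
    Literature.Probability.LatticeModels.CollarLegModel.LegInsertionData) (V' n)) → (∀ᶠ n in Filter.atTop, 0 <
    (‖Literature.Probability.LatticeModels.CollarLegModel.Zins (V n) (⟨(Finset.univ.erase j).image (p n), fun
    v ↦ ∑ b ∈ (Finset.univ.erase j).filter (fun b ↦ (p n) b = v), L b, (p n) j⟩ :
    Literature.Probability.LatticeModels.CollarLegModel.LegInsertionData)‖ /
    ‖(Literature.Probability.LatticeModels.CollarLegModel.ofDomain (V n)).Z‖)) ∧ Filter.Tendsto (fun n ↦
    (Real.log (‖Literature.Probability.LatticeModels.CollarLegModel.Zins (V n) (⟨(Finset.univ.erase j).image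
    (p n), fun v ↦ ∑ b ∈ (Finset.univ.erase j).filter (fun b ↦ (p n) b = v), L b, (p n) j⟩ :
    Literature.Probability.LatticeModels.CollarLegModel.LegInsertionData)‖ /
    ‖(Literature.Probability.LatticeModels.CollarLegModel.ofDomain (V n)).Z‖) - (∑ i₁ : Fin k, ∑ i₂ ∈
    Finset.univ.filter (fun i₂ : Fin k ↦ i₁ < i₂), (-((if i₁ = j then (1 - (L j : ℝ)) else (L i₁ : ℝ)) * (if
    i₂ = j then (1 - (L j : ℝ)) else (L i₂ : ℝ))) / 6) * Real.log
    (Literature.Probability.LatticeModels.dirichletGreen ((V n).image (fun v : ℤ × ℤ ↦ (![v.1, v.2] : Fin 2 →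
    ℤ))) (![((p n) i₁).1, ((p n) i₁).2] : Fin 2 → ℤ) (![((p n) i₂).1, ((p n) i₂).2] : Fin 2 → ℤ)))) -
    (Real.log (‖Literature.Probability.LatticeModels.CollarLegModel.Zins (V' n) (⟨(Finset.univ.erase j).image
    (p' n), fun v ↦ ∑ b ∈ (Finset.univ.erase j).filter (fun b ↦ (p' n) b = v), L b, (p' n) j⟩ :
    Literature.Probability.LatticeModels.CollarLegModel.LegInsertionData)‖ /
    ‖(Literature.Probability.LatticeModels.CollarLegModel.ofDomain (V' n)).Z‖) - (∑ i₁ : Fin k, ∑ i₂ ∈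
    Finset.univ.filter (fun i₂ : Fin k ↦ i₁ < i₂), (-((if i₁ = j then (1 - (L j : ℝ)) else (L i₁ : ℝ)) * (if
    i₂ = j then (1 - (L j : ℝ)) else (L i₂ : ℝ))) / 6) * Real.log
    (Literature.Probability.LatticeModels.dirichletGreen ((V' n).image (fun v : ℤ × ℤ ↦ (![v.1, v.2] : Fin 2 →
    ℤ))) (![((p' n) i₁).1, ((p' n) i₁).2] : Fin 2 → ℤ) (![((p' n) i₂).1, ((p' n) i₂).2] : Fin 2 → ℤ)))))
    Filter.atTop (nhds 0)) → (∀ (k : ℕ) (L : Fin k → ℕ) (j : Fin k), L j = ∑ i ∈ Finset.univ.erase j, L i → (∃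
    i, i ≠ j) → (∀ i, i ≠ j → 1 ≤ L i) → ∃ D₀ : Literature.Probability.RandomPlanarGeometry.MarkedDomain k, (∃
    S : Finset (ℂ × ℂ), (∀ q ∈ S, q.1.re = q.2.re ∨ q.1.im = q.2.im) ∧ frontier D₀.carrier ⊆ ⋃ q ∈ S, segment
    ℝ q.1 q.2) ∧ (∀ i, (∃ r : ℝ, 0 < r ∧ ((∀ z ∈ frontier D₀.carrier, dist z (D₀.pt i) < r → z.im = (D₀.pt
    i).im) ∨ (∀ z ∈ frontier D₀.carrier, dist z (D₀.pt i) < r → z.re = (D₀.pt i).re)))) ∧ (∃ τ : ℂ, ‖τ‖ = 1 ∧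
    (∃ ε : ℝ, 0 < ε ∧ ∀ t ∈ Set.Ioo (D₀.mark j) (D₀.mark j + ε), ∃ s : ℝ, 0 < s ∧ D₀.boundary t = D₀.pt j + (s
    : ℂ) * τ) ∧ (∃ ε : ℝ, 0 < ε ∧ ∀ s ∈ Set.Ioo (0 : ℝ) ε, D₀.pt j + (s : ℂ) * (τ * Complex.I) ∈ D₀.carrier))
    ∧ (∀ (δ : ℕ → ℝ), (∀ n, 0 < δ n) → Filter.Tendsto δ Filter.atTop (nhds 0) → ∀ (V : ℕ → Finset (ℤ × ℤ)), (∀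
    n, ∀ v : ℤ × ℤ, v ∈ V n ↔ (((v).1 : ℂ) * ((δ n : ℝ) : ℂ) + ((v).2 : ℂ) * ((δ n : ℝ) : ℂ) * Complex.I) ∈
    closure D₀.carrier) → ∃ p : ℕ → Fin k → ℤ × ℤ, (∀ n, Function.Injective ((p) n)) ∧ (∀ i, Filter.Tendsto
    (fun n ↦ ((((p) n i).1 : ℂ) * ((δ n : ℝ) : ℂ) + (((p) n i).2 : ℂ) * ((δ n : ℝ) : ℂ) * Complex.I))
    Filter.atTop (nhds (D₀.pt i))) ∧ ∃ N : ℕ, ∀ n, N ≤ n →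
    Literature.Probability.LatticeModels.CollarLegModel.LegInsertionData.IsAdmissible (⟨(Finset.univ.erase
    j).image (p n), fun v ↦ ∑ b ∈ (Finset.univ.erase j).filter (fun b ↦ (p n) b = v), L b, (p n) j⟩ :
    Literature.Probability.LatticeModels.CollarLegModel.LegInsertionData) (V n)) ∧ ∃ ℓ : ℝ, ∀ (δ : ℕ → ℝ), (∀
    n, 0 < δ n) → Filter.Tendsto δ Filter.atTop (nhds 0) → ∀ (V : ℕ → Finset (ℤ × ℤ)), (∀ n, ∀ v : ℤ × ℤ, v ∈
    V n ↔ (((v).1 : ℂ) * ((δ n : ℝ) : ℂ) + ((v).2 : ℂ) * ((δ n : ℝ) : ℂ) * Complex.I) ∈ closure D₀.carrier) →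
    ∀ (p : ℕ → Fin k → ℤ × ℤ), (∀ n, Function.Injective ((p) n)) → (∀ i, Filter.Tendsto (fun n ↦ ((((p) n i).1
    : ℂ) * ((δ n : ℝ) : ℂ) + (((p) n i).2 : ℂ) * ((δ n : ℝ) : ℂ) * Complex.I)) Filter.atTop (nhds (D₀.pt i)))
    → (∀ n, Literature.Probability.LatticeModels.CollarLegModel.LegInsertionData.IsAdmissible
    (⟨(Finset.univ.erase j).image ((p) n), fun v ↦ ∑ b ∈ (Finset.univ.erase j).filter (fun b ↦ ((p) n) b = v),
    L b, ((p) n) j⟩ : Literature.Probability.LatticeModels.CollarLegModel.LegInsertionData) (V n)) →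
    Filter.Tendsto (fun n ↦ (Real.log (‖Literature.Probability.LatticeModels.CollarLegModel.Zins (V n)
    (⟨(Finset.univ.erase j).image (p n), fun v ↦ ∑ b ∈ (Finset.univ.erase j).filter (fun b ↦ (p n) b = v), L
    b, (p n) j⟩ : Literature.Probability.LatticeModels.CollarLegModel.LegInsertionData)‖ /
    ‖(Literature.Probability.LatticeModels.CollarLegModel.ofDomain (V n)).Z‖) - (∑ i₁ : Fin k, ∑ i₂ ∈
    Finset.univ.filter (fun i₂ : Fin k ↦ i₁ < i₂), (-((if i₁ = j then (1 - (L j : ℝ)) else (L i₁ : ℝ)) * (if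
    i₂ = j then (1 - (L j : ℝ)) else (L i₂ : ℝ))) / 6) * Real.log
    (Literature.Probability.LatticeModels.dirichletGreen ((V n).image (fun v : ℤ × ℤ ↦ (![v.1, v.2] : Fin 2 →
    ℤ))) (![((p n) i₁).1, ((p n) i₁).2] : Fin 2 → ℤ) (![((p n) i₂).1, ((p n) i₂).2] : Fin 2 → ℤ)))))
    Filter.atTop (nhds ℓ)) → (∃ c : ℝ, 0 < c ∧ ∀ (D :
    Literature.Probability.RandomPlanarGeometry.JordanDomain), (∃ S : Finset (ℂ × ℂ), (∀ q ∈ S, q.1.re =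
    q.2.re ∨ q.1.im = q.2.im) ∧ frontier D.carrier ⊆ ⋃ q ∈ S, segment ℝ q.1 q.2) → ∀ (x y : ℂ), x ∈ frontier
    D.carrier → y ∈ frontier D.carrier → x ≠ y → (∃ r : ℝ, 0 < r ∧ ((∀ z ∈ frontier D.carrier, dist z (x) < r
    → z.im = (x).im) ∨ (∀ z ∈ frontier D.carrier, dist z (x) < r → z.re = (x).re))) → (∃ r : ℝ, 0 < r ∧ ((∀ z
    ∈ frontier D.carrier, dist z (y) < r → z.im = (y).im) ∨ (∀ z ∈ frontier D.carrier, dist z (y) < r → z.re =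
    (y).re))) → ∀ (w : ℂ → ℂ) (U : Set ℂ), IsOpen U → D.carrier ⊆ U → x ∈ U → y ∈ U → DifferentiableOn ℂ w U →
    Set.BijOn w D.carrier {z : ℂ | 0 < z.im} → ∀ (δ : ℕ → ℝ), (∀ n, 0 < δ n) → Filter.Tendsto δ Filter.atTop
    (nhds 0) → ∀ (V : ℕ → Finset (ℤ × ℤ)), (∀ n, ∀ v : ℤ × ℤ, v ∈ V n ↔ (((v).1 : ℂ) * ((δ n : ℝ) : ℂ) +
    ((v).2 : ℂ) * ((δ n : ℝ) : ℂ) * Complex.I) ∈ closure D.carrier) → ∀ (a b : ℕ → ℤ × ℤ), (∀ n, a n ∈ V n ∧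
    ((Literature.Probability.LatticeModels.CollarLegModel.neighbours (a n)).filter (fun u ↦ u ∉ V n)).card =
    1) → (∀ n, b n ∈ V n ∧ ((Literature.Probability.LatticeModels.CollarLegModel.neighbours (b n)).filter (fun
    u ↦ u ∉ V n)).card = 1) → Filter.Tendsto (fun n ↦ (((a n).1 : ℂ) * ((δ n : ℝ) : ℂ) + ((a n).2 : ℂ) * ((δ n
    : ℝ) : ℂ) * Complex.I)) Filter.atTop (nhds x) → Filter.Tendsto (fun n ↦ (((b n).1 : ℂ) * ((δ n : ℝ) : ℂ) +
    ((b n).2 : ℂ) * ((δ n : ℝ) : ℂ) * Complex.I)) Filter.atTop (nhds y) → Filter.Tendsto (fun n ↦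
    (Literature.Probability.LatticeModels.dirichletGreen ((V n).image (fun v : ℤ × ℤ ↦ (![v.1, v.2] : Fin 2 →
    ℤ))) (![(a n).1, (a n).2] : Fin 2 → ℤ) (![(b n).1, (b n).2] : Fin 2 → ℤ)) / (δ n) ^ 2) Filter.atTop (nhds
    (c * (‖deriv w x‖ * ‖deriv w y‖ / ‖w x - w y‖ ^ 2)))) →
    Summit.CriticalPhenomena.CardyFormulaZ2.Theses.CardyBoundaryCoulombGas.BoundaryDefectGaussianR := by
  intro hRig hRef hGreen k L j hL
  by_cases hnd : (∃ i, i ≠ j) ∧ (∀ i, i ≠ j → 1 ≤ L i)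
  swap
  · exact s6_transferDegenerate k L j hnd
  obtain ⟨D₀, hrect₀, hflat₀, hor₀, happ₀, ℓ, hlim₀⟩ := hRef k L j hL hnd.1 hnd.2
  obtain ⟨c, hc, hG⟩ := hGreen
  have hsum1 := transfer_sum_labels L j hL
  refine ⟨Real.exp ℓ * c ^ (∑ i : Fin k, ∑ i' ∈ Finset.univ.filter (fun i' : Fin k ↦ i < i'),
    (-((if i = j then (1 - (L j : ℝ)) else (L i : ℝ)) * (if i' = j then (1 - (L j : ℝ)) else (L i' : ℝ)))
      / 6)), by positivity, ?_⟩
  intro D hrect hflat w U hU hsub hpt hw hbij hmono δ hδ hδ0 V hV p hpinj hplim hadm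
  obtain ⟨hor, hderiv, hwinj⟩ := s6_flatMarkGeometry k D hflat w U hU hsub hpt hw hbij hmono
  -- boundary-vertex facts for the insertion points, from admissibility
  have hbv : ∀ i n, p n i ∈ V n ∧
      ((CollarLegModel.neighbours (p n i)).filter (fun u ↦ u ∉ V n)).card = 1 :=
    fun i n ↦ s6_boundaryVertices k L j (V n) (p n) (hadm n) i
  -- the reference lattice domains
  have hfin : ∀ n, {v : ℤ × ℤ | ((v.1 : ℂ) * ((δ n : ℝ) : ℂ) + (v.2 : ℂ) * ((δ n : ℝ) : ℂ) *
      Complex.I) ∈ closure D₀.carrier}.Finite :=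
    fun n ↦ transfer_lattice_finite _ D₀.isBounded.closure _ (hδ n)
  obtain ⟨V₀, hV₀⟩ : ∃ V₀ : ℕ → Finset (ℤ × ℤ), ∀ n, ∀ v : ℤ × ℤ, v ∈ V₀ n ↔ (((v).1 : ℂ) *
      ((δ n : ℝ) : ℂ) + ((v).2 : ℂ) * ((δ n : ℝ) : ℂ) * Complex.I) ∈ closure D₀.carrier :=
    ⟨fun n ↦ (hfin n).toFinset, fun n v ↦ by rw [Set.Finite.mem_toFinset]; rfl⟩
  obtain ⟨p₀, hp₀inj, hp₀lim, N, hp₀adm⟩ := happ₀ δ hδ hδ0 V₀ hV₀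
  -- rigidity and the reference limit along the shifted sequences
  have hδ' : ∀ n, 0 < δ (n + N) := fun n ↦ hδ _
  have hδ0' : Filter.Tendsto (fun n ↦ δ (n + N)) Filter.atTop (nhds 0) :=
    hδ0.comp (tendsto_add_atTop_nat N)
  obtain ⟨hpos', hdiff'⟩ := hRig k L j hL D D₀ hrect hflat (hor j) hrect₀ hflat₀ hor₀
    (fun n ↦ δ (n + N)) hδ' hδ0' (fun n ↦ V (n + N)) (fun n ↦ V₀ (n + N)) (fun n ↦ hV (n + N))
    (fun n ↦ hV₀ (n + N)) (fun n ↦ p (n + N)) (fun n ↦ p₀ (n + N)) (fun n ↦ hpinj (n + N))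
    (fun n ↦ hp₀inj (n + N)) (fun i ↦ (hplim i).comp (tendsto_add_atTop_nat N))
    (fun i ↦ (hp₀lim i).comp (tendsto_add_atTop_nat N)) (fun n ↦ hadm (n + N))
    (fun n ↦ hp₀adm (n + N) (Nat.le_add_left N n))
  have hlim' := hlim₀ (fun n ↦ δ (n + N)) hδ' hδ0' (fun n ↦ V₀ (n + N)) (fun n ↦ hV₀ (n + N))
    (fun n ↦ p₀ (n + N)) (fun n ↦ hp₀inj (n + N))
    (fun i ↦ (hp₀lim i).comp (tendsto_add_atTop_nat N))
    (fun n ↦ hp₀adm (n + N) (Nat.le_add_left N n))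
  -- the limit value in the crux's shape
  have hval := transfer_limit_value (fun i ↦ if i = j then (1 - (L j : ℝ)) else (L i : ℝ)) hsum1 c ℓ
    hc (fun i ↦ w (D.pt i)) (fun i ↦ deriv w (D.pt i)) hwinj hderiv
  beta_reduce at hval
  rw [← hval]
  refine transfer_limit
    (fun n ↦ ‖Literature.Probability.LatticeModels.CollarLegModel.Zins (V n) ⟨(Finset.univ.erase
      j).image (p n), fun v ↦ ∑ i ∈ (Finset.univ.erase j).filter (fun i ↦ p n i = v), L i, p n j⟩‖)
    (fun n ↦ ‖(Literature.Probability.LatticeModels.CollarLegModel.ofDomain (V n)).Z‖) δ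
    (fun n i₁ i₂ ↦ Literature.Probability.LatticeModels.dirichletGreen ((V n).image (fun v : ℤ × ℤ ↦
      (![v.1, v.2] : Fin 2 → ℤ))) (![((p n) i₁).1, ((p n) i₁).2] : Fin 2 → ℤ)
      (![((p n) i₂).1, ((p n) i₂).2] : Fin 2 → ℤ))
    (fun i₁ i₂ ↦ (-((if i₁ = j then (1 - (L j : ℝ)) else (L i₁ : ℝ)) *
      (if i₂ = j then (1 - (L j : ℝ)) else (L i₂ : ℝ))) / 6))
    (fun i i' ↦ ‖deriv w (D.pt i)‖ * ‖deriv w (D.pt i')‖ / ‖w (D.pt i) - w (D.pt i')‖ ^ 2)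
    (∑ i : Fin k, (if i = j then (1 - (L j : ℝ)) else (L i : ℝ)) *
      ((if i = j then (1 - (L j : ℝ)) else (L i : ℝ)) - 1) / 6) c ℓ hδ hc ?_ ?_ ?_ ?_ ?_
  · -- hK
    intro i i' hii'
    exact div_pos (mul_pos (norm_pos_iff.mpr (hderiv i)) (norm_pos_iff.mpr (hderiv i')))
      (pow_pos (norm_pos_iff.mpr (sub_ne_zero.mpr (hwinj i i' hii'.ne))) 2)
  · -- hH
    exact transfer_mesh (fun i ↦ if i = j then (1 - (L j : ℝ)) else (L i : ℝ)) hsum1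
  · -- hP
    exact transfer_eventually_of_shift N hpos'
  · -- hF
    rw [← zero_add ℓ]
    refine (Filter.tendsto_add_atTop_iff_nat N).mp ?_
    exact Filter.Tendsto.congr (fun n ↦ sub_add_cancel _ _) (hdiff'.add hlim')
  · -- hG
    intro i i' hii'
    exact hG D.toJordanDomain hrect (D.pt i) (D.pt i') (D.pt_mem_frontier i) (D.pt_mem_frontier i')
      (fun h ↦ hii'.ne (D.pt_injective h)) (hflat i) (hflat i') w U hU hsub (hpt i) (hpt i') hw hbij
      δ hδ hδ0 V hV (fun n ↦ p n i) (fun n ↦ p n i') (hbv i) (hbv i') (hplim i) (hplim i')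

end Summit.CriticalPhenomena.CardyFormulaZ2.Cruxes.BoundaryDefectGaussianR.RainbowMonomialsInExcursionKernels

end
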